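import Literature.Probability.LatticeModels.DiscreteFaceBoundary
import Literature.Topology.PlaneTopology.Crosscut
import Mathlib.Analysis.InnerProductSpace.Basic
import HarnessLib

/-!
# Vocabulary for `DiscretisationFamilyExists` (stmt-CriticalPhenomena-9644): the data of one leg of the cross-cut

Route `CardySusyWard` (sub-problem `CriticalPhenomena/CardyFormulaZ2`), item
`Summit.CriticalPhenomena.CardyFormulaZ2.Theses.CardySusyWard.DiscretisationFamilyExists`.
The proof (helper files `Theorems/CardySusyWardDiscretisationFamilyExists*.lean`) labels the
square-lattice boundary of the canonical discrete domain by the two sides of a CROSS-CUT of the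
Jordan domain built from two LEGS (one near each marked point) joined by a deep arc.  This file
carries, assertion-free, the one bundled object shared by the leg construction (in a standard
orientation), its dihedral transport, and the assembly: `LegData Ω δ a η p` — the plug arc `P` from
the junction `m` to the landing point `c ∈ ∂Ω`, the straight run `segment m ztop` back to the deep
point, the cut edge `s(u, v)` crossed at `pstar`, the sector point `z₀`, and the finitely many
properties the assembly consumes (simple arcs meeting in `m`; inside `Ω` but for `c`; inside the
window `ball a η`; off the mesh points of boundary sites; meeting closed `Ω_δ`-edges between
boundary sites only in `pstar`; the cut edge borders exactly one inner face; the sector and access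
data making the cut edge bichromatic; the far-pole boxes of both ends free; the pair
non-degenerate).  Nothing is asserted here.
-/

noncomputable section

open Set Metric
open Literature.Probability.LatticeModels

namespace Summit.CriticalPhenomena.CardyFormulaZ2.Theorems.DiscretisationFamilyExists

/-- **The data of one leg of the cross-cut** near the marked point `a` (window radius `η`, deep
point `p`) for the bare discrete data `⟨Ω, δ, ∅, ∅⟩`.  See the module docstring for the rôle of
each field. [folklore] -/
structure LegData (Ω : Set ℂ) (δ : ℝ) (a : ℂ) (η : ℝ) (p : ℂ) where
  /-- landing point of the leg on `∂Ω` -/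
  c : ℂ
  /-- junction of the plug arc and the straight run -/
  m : ℂ
  /-- deep end of the straight run -/
  ztop : ℂ
  /-- the point where the leg crosses the cut edge (its midpoint) -/
  pstar : ℂ
  /-- sector point: a point of the plug inside `Ω` near `pstar` -/
  z₀ : ℂ
  /-- radius of the sector ball -/
  ε : ℝ
  /-- the two ends of the cut edge, `v = u + cornerUnit mv` -/
  u : Site 2
  /-- the two ends of the cut edge, `v = u + cornerUnit mv` -/
  v : Site 2
  /-- direction from `u` to `v` -/
  mv : Fin 4
  /-- the plug arc, from `m` to `c` -/
  P : Set ℂ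
  hv : v = u + cornerUnit mv
  arcP : Literature.Topology.PlaneTopology.IsSimpleArc P m c
  m_ne_ztop : m ≠ ztop
  inter_eq : P ∩ segment ℝ m ztop = {m}
  c_mem : c ∈ frontier Ω
  subset_Ω : P \ {c} ⊆ Ω
  run_subset_Ω : segment ℝ m ztop ⊆ Ω
  subset_ball : P ∪ segment ℝ m ztop ⊆ ball a η
  dist_ztop : dist ztop p ≤ 2 * δ
  mesh_not_mem : ∀ x ∈ (⟨Ω, δ, ∅, ∅⟩ : DiscreteDobrushin).zdBoundary,
    meshPoint δ x ∉ P ∪ segment ℝ m ztop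
  u_mem : u ∈ (⟨Ω, δ, ∅, ∅⟩ : DiscreteDobrushin).zdBoundary
  v_mem : v ∈ (⟨Ω, δ, ∅, ∅⟩ : DiscreteDobrushin).zdBoundary
  edge_mem : s(u, v) ∈ (discreteDomainGraph Ω δ).edgeSet
  existsUnique_inner : ∃! f, (⟨Ω, δ, ∅, ∅⟩ : DiscreteDobrushin).IsInnerFace f ∧ IsCorner u f ∧ IsCorner v f
  pstar_mem : pstar ∈ P
  pstar_eq : pstar = (2⁻¹ : ℝ) • (meshPoint δ u + meshPoint δ v)
  subset_closedBall : P ⊆ closedBall c (5 * δ)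
  dist_u_c : dist (meshPoint δ u) c ≤ 5 * δ
  dist_v_c : dist (meshPoint δ v) c ≤ 5 * δ
  inter_edge_subset : ∀ x ∈ (⟨Ω, δ, ∅, ∅⟩ : DiscreteDobrushin).zdBoundary,
    ∀ y ∈ (⟨Ω, δ, ∅, ∅⟩ : DiscreteDobrushin).zdBoundary, (discreteDomainGraph Ω δ).Adj x y →
    (P ∪ segment ℝ m ztop) ∩ segment ℝ (meshPoint δ x) (meshPoint δ y) ⊆ {pstar}
  z₀_mem : z₀ ∈ P
  ε_pos : 0 < ε
  ε_le : ε ≤ δ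
  ball_subset : ball z₀ ε ⊆ Ω
  inter_ball_subset : (P ∪ segment ℝ m ztop) ∩ ball z₀ ε ⊆
    {z | inner (ℝ) (z - z₀) (meshPoint δ v - meshPoint δ u) = 0}
  access_u : ∃ q ∈ ball z₀ ε, 0 < inner (ℝ) (q - z₀) (meshPoint δ u - meshPoint δ v) ∧
    segment ℝ (meshPoint δ u) q ⊆ Ω \ (P ∪ segment ℝ m ztop)
  access_v : ∃ q ∈ ball z₀ ε, 0 < inner (ℝ) (q - z₀) (meshPoint δ v - meshPoint δ u) ∧
    segment ℝ (meshPoint δ v) q ⊆ Ω \ (P ∪ segment ℝ m ztop)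
  box_v : ∀ z ∈ P ∪ segment ℝ m ztop, z ∈ Ω → ∀ α β : ℝ, 0 ≤ α → α ≤ 2 → -1 ≤ β → β ≤ 1 →
    z ≠ meshPoint δ v + α • meshPoint δ (cornerUnit mv) + β • meshPoint δ (cornerUnit (mv + 1))
  box_u : ∀ z ∈ P ∪ segment ℝ m ztop, z ∈ Ω → ∀ α β : ℝ, 0 ≤ α → α ≤ 2 → -1 ≤ β → β ≤ 1 →
    z ≠ meshPoint δ u + α • meshPoint δ (cornerUnit (mv + 2)) + β • meshPoint δ (cornerUnit (mv + 2 + 1))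
  nondeg : ¬ (δ + infDist (meshPoint δ v) (frontier Ω) ≤ infDist (meshPoint δ u) (frontier Ω)) ∧
    ¬ (δ + infDist (meshPoint δ u) (frontier Ω) ≤ infDist (meshPoint δ v) (frontier Ω))

end Summit.CriticalPhenomena.CardyFormulaZ2.Theorems.DiscretisationFamilyExists

end
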